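import Summits.QuantumFields.BalabanUV.T4Continuum.Support.SubstrateVocabularyV3
import Summits.QuantumFields.BalabanUV.T4Continuum.Support.MinimalActionLevels

/-!
# SUBSTRATE — VOCABULARY V1 ↔ V3, part 1b (the Wilson action and the level re-indexing): row NE3's `fineAction` of the periodic
# lift on one period window IS the Wilson action of record, and NE3's level-`k` action `levelAction` at `N = 2L^m`, `k = K − j` IS
# the level-`j` action of record up to the printed weight `(L^{d−4})^{K−j}`

Cell `pub-balaban`, SUBSTRATE cell, seat `b2b-balaban-substrate-p2`; registry item S-VOC-2 (MAP v0.3 §4 p2 (3), [dict] line D-3), part 1b —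
independent of the averaging question raised in the journal finding F-SUB-p2-1 (the action and the plaquettes are common to B7 (42) and
B12 (0.4)).  Follower of `SubstrateVocabularyV3` (p219008: `toZMod`, `liftCfg`, `hol_liftCfg_plaqWord_of_lt`) and of row NE3's
`MinimalActionLevels` (`perWin`, `levelAction`, `stepWt`) BY NAME; edits nothing.

HONEST FRAMING (T4-DAG p. 1).  Rung (B)+1 of the FINITE-VOLUME T⁴ continuum programme — NOT infinite volume, NOT a mass gap, NOT the
Clay problem, NOT summit progress, no estimate; a DICTIONARY (identities only).  HONEST DEPENDENCY (cell line, verbatim): continuum YM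
on T⁴ ⇐ BetaPertH ∧ nine spine estimates (0/9 proved); BetaPertH ⇐ (D1) ∧ (D4) ∧ CAP+tail; G-an2-4 gates asym, D1 and NE2/3/4.

WHAT THIS FILE PROVES ([Balaban1985Variational] (5) p. 278 `A^{(k)}(U) = Σ_p (1 − Re tr U(∂p))` read in both vocabularies).
* §1 `boxSite j r := toZMod j (boxVec r)` — the period box `{0,…,N_j−1}^d` of integer labels enumerates the level-`j` torus BIJECTIVELY
  (`boxSite_bijective`); `plaqEquiv : Plaq P j ≃ Site P j × Plane d`; hence `wilsonAction_eq_sum_box` (the Wilson action of record as a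
  sum over box labels and planes) and `fineAction_perWin_eq_sum_box` (NE3's window action as the same kind of sum, `boxVec_injective`).
* §2 **`fineAction_liftCfg_perWin`**: for a morphism `ι : G →* (Matrix n n ℂ)ˣ` COMPATIBLE WITH THE TRACES (displayed:
  `hι : nReTr (ι g) = reTr g`; for `G = U(n)` with `ι = Unitary.toUnits` this is `rfl` — `nReTr_toUnits`, §4),
  `fineAction (liftCfg ι U) (perWin d N_j) = wilsonAction4 U`.
* §3 **LEVEL RE-INDEXING** `sitesPerDir_eq_level : N_j = (2·L^m)·L^{K−j}` (`j ≤ K`) and **`levelAction_liftCfg`**: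
  `levelAction d L (2·L^m) (K − j) (liftCfg ι U) = (stepWt d L)⁻¹^{K−j} · wilsonAction4 U` — V1's level `j` (lattice `T^{(j)}`, `N_j`
  sites per direction) is V3's level `k = K − j` over the unit torus of side `N = 2·L^m`.
No estimate, no `def … : Prop`, no `sorry`.
-/

noncomputable section

open scoped BigOperators Matrix.Norms.L2Operator

namespace Summit.QuantumFields.BalabanUV.T4Continuum.SubstrateVocabularyV3

open Literature.MathematicalPhysics.QuantumFieldTheory.Balaban1983to89
open Literature.MathematicalPhysics.QuantumFieldTheory.Balaban1983to89.B7Prop1Explicit (boxVec plaqWord hol)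
open Literature.MathematicalPhysics.QuantumFieldTheory.Balaban1983to89.T4AveragingDeficitWall (Plane fhol wt fineAction)
open Literature.MathematicalPhysics.QuantumFieldTheory.Balaban1983to89.T4AveragingDeficitWallBoundary (periodBox)
open Literature.MathematicalPhysics.QuantumFieldTheory.Balaban1983to89.UnitaryModel (nReTr)
open Summit.QuantumFields.BalabanUV.T4Continuum.MinimalActionLevels (perWin levelAction stepWt)

variable {P : Params} {j : ℕ}

/-! ## §1 The period box enumerates the torus; plaquettes as (site, plane) -/

/-- [folklore] THE BOX ENUMERATION of the level-`j` torus: the label `r ∈ {0,…,N_j−1}^d` names the site `toZMod j (boxVec r)`. -/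
def boxSite (j : ℕ) (r : Fin P.d → Fin (P.sitesPerDir j)) : Site P j := toZMod j (boxVec (P.sitesPerDir j) r)

/-- [folklore] `boxSite` coordinatewise. -/
@[simp] theorem boxSite_apply (r : Fin P.d → Fin (P.sitesPerDir j)) (μ : Fin P.d) :
    boxSite (P := P) j r μ = ((r μ : ℕ) : ZMod (P.sitesPerDir j)) := by
  simp [boxSite, boxVec]

/-- [folklore] **THE BOX ENUMERATION IS A BIJECTION** onto the torus sites. -/
theorem boxSite_bijective (j : ℕ) : Function.Bijective (boxSite (P := P) j) := by
  constructor
  · intro r r' h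
    funext μ
    have hμ := congrFun h μ
    rw [boxSite_apply, boxSite_apply] at hμ
    have hv := congrArg ZMod.val hμ
    rw [ZMod.val_cast_of_lt (r μ).isLt, ZMod.val_cast_of_lt (r' μ).isLt] at hv
    exact Fin.ext hv
  · intro y
    refine ⟨fun μ => ⟨(y μ).val, ZMod.val_lt (y μ)⟩, funext fun μ => ?_⟩
    rw [boxSite_apply]
    exact ZMod.natCast_zmod_val (y μ)

/-- [folklore] `boxVec` is injective (distinct labels, distinct integer points). -/
theorem boxVec_injective (N : ℕ) : Function.Injective (boxVec (d := P.d) N) := by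
  intro r r' h
  funext μ
  have hμ := congrFun h μ
  simp only [boxVec, Nat.cast_inj] at hμ
  exact Fin.ext hμ

/-- [folklore] PLAQUETTES OF RECORD AS (SITE, PLANE): `Plaq P j ≃ Site P j × Plane d` (`Plane d = {(μ, ν) // μ < ν}`, row NE3's type). -/
def plaqEquiv : Plaq P j ≃ Site P j × Plane P.d where
  toFun p := (p.src, ⟨(p.μ, p.ν), p.hμν⟩)
  invFun q := ⟨q.1, q.2.1.1, q.2.1.2, q.2.2⟩
  left_inv _ := rfl
  right_inv _ := rfl

section Action

variable {G : Type*} [GaugeGroup G]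

/-- [folklore] **THE WILSON ACTION OF RECORD AS A BOX SUM**: `A_w(U) = Σ_{r ∈ box} Σ_{planes} w (1 − Re tr U(∂p(r, plane)))`. -/
theorem wilsonAction_eq_sum_box (w : ℝ) (U : GaugeField P j G) :
    wilsonAction w U = ∑ r : Fin P.d → Fin (P.sitesPerDir j), ∑ pl : Plane P.d,
      w * (1 - reTr (GaugeField.plaqHol U ⟨boxSite j r, pl.1.1, pl.1.2, pl.2⟩)) := by
  unfold wilsonAction
  rw [Fintype.sum_equiv plaqEquiv (fun p : Plaq P j => w * (1 - reTr (GaugeField.plaqHol U p)))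
    (fun q : Site P j × Plane P.d => w * (1 - reTr (GaugeField.plaqHol U ⟨q.1, q.2.1.1, q.2.1.2, q.2.2⟩))) (fun _ => rfl),
    Fintype.sum_prod_type]
  exact (Fintype.sum_bijective (boxSite j) (boxSite_bijective j) _ _ fun _ => rfl).symm

variable {n : Type*} [Fintype n] [DecidableEq n]

/-- [folklore] **NE3's WINDOW ACTION ON A PERIOD WINDOW AS A BOX SUM**: `fineAction V (perWin d N) = Σ_{r} Σ_{planes} wt (V(∂p(boxVec r, plane)))`. -/
theorem fineAction_perWin_eq_sum_box (V : B7Prop1Explicit.Site P.d → Fin P.d → (Matrix n n ℂ)ˣ) (N : ℕ) :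
    fineAction V (perWin P.d N) = ∑ r : Fin P.d → Fin N, ∑ pl : Plane P.d, wt (fhol V (boxVec N r, pl)) := by
  unfold fineAction perWin periodBox
  rw [Finset.sum_product, Finset.sum_image fun r _ r' _ h => boxVec_injective N h]

/-! ## §2 The window action of the lift is the Wilson action of record -/

/-- [folklore] One plaquette: NE3's plaquette weight of the lift at `(x, plane)` is the plaquette term of record at `toZMod x`, for a
trace-compatible morphism. -/
theorem wt_fhol_liftCfg (ι : G →* (Matrix n n ℂ)ˣ) (hι : ∀ g, nReTr ((ι g : (Matrix n n ℂ)ˣ) : Matrix n n ℂ) = reTr g)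
    (U : GaugeField P j G) (x : B7Prop1Explicit.Site P.d) (pl : Plane P.d) :
    wt (fhol (liftCfg ι U) (x, pl)) = 1 - reTr (GaugeField.plaqHol U ⟨toZMod j x, pl.1.1, pl.1.2, pl.2⟩) := by
  unfold wt fhol
  rw [hol_liftCfg_plaqWord_of_lt ι U x pl.2, hι]

/-- [folklore] **ACTION DICTIONARY**: for a morphism `ι : G →* (Matrix n n ℂ)ˣ` compatible with the traces (`nReTr ∘ ι = reTr`), row
NE3's Wilson action of the periodic lift on ONE PERIOD WINDOW is the Wilson action of record:
`fineAction (liftCfg ι U) (perWin d N_j) = wilsonAction4 U` ([Balaban1985Variational] (5) in both vocabularies). -/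
theorem fineAction_liftCfg_perWin (ι : G →* (Matrix n n ℂ)ˣ) (hι : ∀ g, nReTr ((ι g : (Matrix n n ℂ)ˣ) : Matrix n n ℂ) = reTr g)
    (U : GaugeField P j G) : fineAction (liftCfg ι U) (perWin P.d (P.sitesPerDir j)) = wilsonAction4 U := by
  rw [fineAction_perWin_eq_sum_box, wilsonAction4, wilsonAction_eq_sum_box]
  refine Finset.sum_congr rfl fun r _ => Finset.sum_congr rfl fun pl _ => ?_
  rw [wt_fhol_liftCfg ι hι, one_mul]
  rfl

/-! ## §3 Level re-indexing: V1 level `j` = V3 level `K − j` over the unit torus of side `2·L^m` -/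

omit [Fintype n] [DecidableEq n] in
/-- [folklore] **THE PERIODS AGREE**: `N_j = (2·L^m) · L^{K−j}` for `j ≤ K` (`Params.sitesPerDir j = 2·L^{m+K−j}`). -/
theorem sitesPerDir_eq_level (hj : j ≤ P.K) : P.sitesPerDir j = (2 * P.L ^ P.m) * P.L ^ (P.K - j) := by
  unfold Params.sitesPerDir
  rw [Nat.add_sub_assoc hj, pow_add, mul_assoc]

/-- [folklore] **LEVEL DICTIONARY**: NE3's level-`(K − j)` action over the unit torus of side `N = 2·L^m` of the lift of a level-`j` field
of record is `(L^{d−4})⁻¹^{K−j}` times its Wilson action of record (for `d = 4` the weight is `1`). -/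
theorem levelAction_liftCfg (ι : G →* (Matrix n n ℂ)ˣ) (hι : ∀ g, nReTr ((ι g : (Matrix n n ℂ)ˣ) : Matrix n n ℂ) = reTr g)
    (hj : j ≤ P.K) (U : GaugeField P j G) :
    levelAction P.d P.L (2 * P.L ^ P.m) (P.K - j) (liftCfg ι U) = ((stepWt P.d P.L)⁻¹) ^ (P.K - j) * wilsonAction4 U := by
  unfold levelAction
  rw [← sitesPerDir_eq_level hj, fineAction_liftCfg_perWin ι hι]

end Action

section Unitary

variable {n : Type*} [Fintype n] [DecidableEq n] [Nonempty n]

/-- [folklore] **TRACE COMPATIBILITY FOR `U(n)`**: with `ι = Unitary.toUnits` (Mathlib) on `G = Matrix.unitaryGroup n ℂ` (a `GaugeGroup` through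
its fundamental representation, `UnitaryModel.instGaugeGroupUnitaryGroup`), the hypothesis `hι` of §2–§3 holds by `rfl`
(`GaugeGroup.ofUnitaryRep_reTr`). -/
theorem nReTr_toUnits (g : Matrix.unitaryGroup n ℂ) :
    nReTr ((Unitary.toUnits g : (Matrix n n ℂ)ˣ) : Matrix n n ℂ) = reTr g := rfl

end Unitary

end Summit.QuantumFields.BalabanUV.T4Continuum.SubstrateVocabularyV3

end
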